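import Literature.Geometry.Riemannian.MetricFlowConcentration
import Mathlib.Probability.Kernel.Disintegration.StandardBorel
import Mathlib.Probability.Kernel.Composition.MeasureCompProd
import HarnessLib

/-!
# GLUING: a coupling of the images `r_*ν, r_*μ` lifts to a coupling of `ν, μ` with the same `r`-dependent cost (disintegration along `r`)

Seat `ym-line-csu-p1` (g43), route `ColdStartUniversality` of `Summits/QuantumFields/YangMills`, GENERIC helper file (`--supports stmt-QuantumFields-24809`).
For standard Borel `X, Y`, a measurable `r : X → Y`, probability measures `ν, μ` on `X` and a coupling `π_Y` of `r_*ν, r_*μ`: disintegrate `ν, μ` along `r`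
(`Measure.condKernel` of the graph measures), glue the conditional laws independently over `π_Y`, and obtain a coupling `P` of `ν, μ` with
`∫ c(r x, r x') dP = ∫ c dπ_Y` for every measurable cost `c` on `Y × Y` (the conditional laws live on the fibres of `r`).  With
`…OptimalTransportCouplingCompactness` this is the tool for assembling window-wise transport bounds (Talagrand for infinite-volume limit points,
`…ShenZhuZhuTalagrandWindowsSU2`) into a single coupling on the full configuration space.
* ★★★ `exists_isCoupling_lift_of_map`.
THEOREMS ONLY, no definition, no sorry.  HONEST FRAMING: generic measure theory; nothing about Yang–Mills is proved here; the Yang–Mills mass gap is NOT proved.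
-/

set_option autoImplicit false

noncomputable section

namespace Summit.QuantumFields.YangMills.Theorems.ColdStartUniversality

open MeasureTheory ProbabilityTheory Filter Set
open scoped NNReal ENNReal ProbabilityTheory

/-- ★★★ **Gluing lemma along a measurable map.**  `X, Y` standard Borel, `r : X → Y` measurable, `ν, μ` probability measures on `X`, `π_Y` a coupling of
`r_*ν` and `r_*μ`.  Then there is a coupling `P` of `ν` and `μ` with `∫⁻ c(r z₁, r z₂) dP(z) = ∫⁻ c dπ_Y` for every measurable `c : Y × Y → [0,∞]`
(`P = ∫ κ_ν(u) ⊗ κ_μ(v) dπ_Y(u,v)` with the conditional laws `κ` of `ν, μ` given `r`). [cite: Villani2003, Lemma 7.6] -/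
theorem exists_isCoupling_lift_of_map {X Y : Type*} [MeasurableSpace X] [StandardBorelSpace X] [Nonempty X]
    [MeasurableSpace Y] [StandardBorelSpace Y]
    (ν μ : Measure X) [IsProbabilityMeasure ν] [IsProbabilityMeasure μ] {r : X → Y} (hr : Measurable r)
    {πY : Measure (Y × Y)} (hπY : Literature.Geometry.Riemannian.IsCoupling (ν.map r) (μ.map r) πY)
    {c : Y × Y → ℝ≥0∞} (hc : Measurable c) :
    ∃ P : Measure (X × X), Literature.Geometry.Riemannian.IsCoupling ν μ P ∧ ∫⁻ z, c (r z.1, r z.2) ∂P = ∫⁻ w, c w ∂πY := by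
  classical
  haveI : IsProbabilityMeasure πY := hπY.1
  have hgm : Measurable (fun x : X => (r x, x)) := hr.prodMk measurable_id'
  -- graph measures and their disintegrations
  obtain ⟨gν, hgν⟩ : ∃ g : Measure (Y × X), g = ν.map (fun x : X => (r x, x)) := ⟨_, rfl⟩
  obtain ⟨gμ, hgμ⟩ : ∃ g : Measure (Y × X), g = μ.map (fun x : X => (r x, x)) := ⟨_, rfl⟩
  haveI : IsProbabilityMeasure gν := by rw [hgν]; exact Measure.isProbabilityMeasure_map hgm.aemeasurable
  haveI : IsProbabilityMeasure gμ := by rw [hgμ]; exact Measure.isProbabilityMeasure_map hgm.aemeasurable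
  have hfstν : gν.fst = ν.map r := by rw [hgν, Measure.fst, Measure.map_map measurable_fst hgm]; rfl
  have hfstμ : gμ.fst = μ.map r := by rw [hgμ, Measure.fst, Measure.map_map measurable_fst hgm]; rfl
  have hsndν : gν.snd = ν := by rw [hgν, Measure.snd, Measure.map_map measurable_snd hgm]; exact Measure.map_id'
  have hsndμ : gμ.snd = μ := by rw [hgμ, Measure.snd, Measure.map_map measurable_snd hgm]; exact Measure.map_id'
  have hdisν : (ν.map r) ⊗ₘ gν.condKernel = gν := by rw [← hfstν]; exact gν.disintegrate _
  have hdisμ : (μ.map r) ⊗ₘ gμ.condKernel = gμ := by rw [← hfstμ]; exact gμ.disintegrate _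
  haveI : IsProbabilityMeasure (ν.map r) := Measure.isProbabilityMeasure_map hr.aemeasurable
  haveI : IsProbabilityMeasure (μ.map r) := Measure.isProbabilityMeasure_map hr.aemeasurable
  -- the conditional laws concentrate on the fibres
  have hS : MeasurableSet {p : Y × X | r p.2 ≠ p.1} := by
    have h1 : MeasurableSet {p : Y × X | r p.2 = p.1} := by
      have hm : Measurable fun p : Y × X => (r p.2, p.1) := (hr.comp measurable_snd).prodMk measurable_fst
      exact hm measurableSet_diagonal
    simpa [Set.compl_setOf] using h1.compl
  have hfib : ∀ (ρ : Measure X) [IsProbabilityMeasure ρ] (g : Measure (Y × X)) [IsProbabilityMeasure g], g = ρ.map (fun x : X => (r x, x)) →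
      (ρ.map r) ⊗ₘ g.condKernel = g → ∀ᵐ u ∂(ρ.map r), g.condKernel u {x | r x ≠ u} = 0 := by
    intro ρ _ g _ hg hdis
    have h0 : ((ρ.map r) ⊗ₘ g.condKernel) {p : Y × X | r p.2 ≠ p.1} = 0 := by
      rw [hdis, hg, Measure.map_apply hgm hS]
      simp
    rw [Measure.compProd_apply hS] at h0
    have hmeas : Measurable fun u => g.condKernel u (Prod.mk u ⁻¹' {p : Y × X | r p.2 ≠ p.1}) :=
      Kernel.measurable_kernel_prodMk_left hS
    have := (lintegral_eq_zero_iff hmeas).1 h0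
    filter_upwards [this] with u hu
    simpa using hu
  have hfibν := hfib ν gν hgν hdisν
  have hfibμ := hfib μ gμ hgμ hdisμ
  -- the glued kernel and coupling
  let K : Kernel (Y × Y) (X × X) :=
    (gν.condKernel.comap Prod.fst measurable_fst) ×ₖ (gμ.condKernel.comap Prod.snd measurable_snd)
  haveI : IsMarkovKernel K := by infer_instance
  have hcomap : ∀ (κ : Kernel Y X) [IsMarkovKernel κ] (f : Y × Y → Y) (hf : Measurable f),
      (κ.comap f hf) ∘ₘ πY = κ ∘ₘ (πY.map f) := by
    intro κ _ f hf
    ext s hs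
    rw [Measure.bind_apply hs (Kernel.aemeasurable _), Measure.bind_apply hs (Kernel.aemeasurable _),
      lintegral_map (Kernel.measurable_coe κ hs) hf]
    rfl
  refine ⟨K ∘ₘ πY, ⟨inferInstance, ?_, ?_⟩, ?_⟩
  · rw [Measure.fst, Measure.map_comp _ _ measurable_fst]
    have hK : K.map Prod.fst = gν.condKernel.comap Prod.fst measurable_fst := by
      rw [← Kernel.fst_eq]; exact Kernel.fst_prod _ _
    rw [hK, hcomap]
    show gν.condKernel ∘ₘ πY.fst = ν
    rw [hπY.2.1, ← Measure.snd_compProd, hdisν, hsndν]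
  · rw [Measure.snd, Measure.map_comp _ _ measurable_snd]
    have hK : K.map Prod.snd = gμ.condKernel.comap Prod.snd measurable_snd := by
      rw [← Kernel.snd_eq]; exact Kernel.snd_prod _ _
    rw [hK, hcomap]
    show gμ.condKernel ∘ₘ πY.snd = μ
    rw [hπY.2.2, ← Measure.snd_compProd, hdisμ, hsndμ]
  · have hcm : Measurable fun z : X × X => c (r z.1, r z.2) := hc.comp ((hr.comp measurable_fst).prodMk (hr.comp measurable_snd))
    rw [Measure.lintegral_bind K.aemeasurable hcm.aemeasurable]
    -- a.e. in `(u,v)`: the inner integral is `c (u,v)`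
    have h1 : ∀ᵐ w ∂πY, gν.condKernel w.1 {x | r x ≠ w.1} = 0 := by
      have := hfibν; rw [← hπY.2.1] at this
      exact ae_of_ae_map measurable_fst.aemeasurable this
    have h2 : ∀ᵐ w ∂πY, gμ.condKernel w.2 {x | r x ≠ w.2} = 0 := by
      have := hfibμ; rw [← hπY.2.2] at this
      exact ae_of_ae_map measurable_snd.aemeasurable this
    refine lintegral_congr_ae ?_
    filter_upwards [h1, h2] with w hw1 hw2
    rw [Kernel.prod_apply, Kernel.comap_apply, Kernel.comap_apply,
      lintegral_prod _ hcm.aemeasurable]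
    have hin : ∀ x : X, ∫⁻ x', c (r (x, x').1, r (x, x').2) ∂(gμ.condKernel w.2) = c (r x, w.2) := by
      intro x
      have hae : ∀ᵐ x' ∂(gμ.condKernel w.2), c (r x, r x') = c (r x, w.2) := by
        have : ∀ᵐ x' ∂(gμ.condKernel w.2), r x' = w.2 := ae_iff.2 hw2
        filter_upwards [this] with x' hx'
        rw [hx']
      rw [lintegral_congr_ae hae, lintegral_const, measure_univ, mul_one]
    simp_rw [hin]
    have hae' : ∀ᵐ x ∂(gν.condKernel w.1), c (r x, w.2) = c (w.1, w.2) := by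
      have : ∀ᵐ x ∂(gν.condKernel w.1), r x = w.1 := ae_iff.2 hw1
      filter_upwards [this] with x hx
      rw [hx]
    rw [lintegral_congr_ae hae', lintegral_const, measure_univ, mul_one]

end Summit.QuantumFields.YangMills.Theorems.ColdStartUniversality
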